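import Summits.QuantumFields.GaugeBoot.ClassB
import Literature.MathematicalPhysics.QuantumLattice.CloverPseudoscalarParity
import HarnessLib

/-!
# Route `DualityDefect`, item `CloverParityRP` (stmt-QuantumFields-11698) — clover lemmas

Elementary facts about the bare clover densities `S_x = flowedCloverEnergy ρ 0 x` and
`P_x = cloverPseudoscalar ρ x` on `ℤᵈ` needed for the reflection-positivity sign rules:

* translation covariance `S_x(shift_v U) = S_{x−v}(U)`, `P_x(shift_v U) = P_{x−v}(U)`
  (`configShift` of `LatticeGaugeDLR`);
* parity under the two Osterwalder–Seiler time mirrors of `GaugeBoot.ClassB` — the site mirror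
  `configSiteReflect 0` (`x₀ ↦ −x₀`) and the link mirror `configLinkReflect 0` (`x₀ ↦ 1 − x₀`):
  `S` is even, `P` is odd (instances of the tree's `flowedCloverEnergy_zero_reflect`,
  `cloverPseudoscalar_reflect`);
* supports: the six off-diagonal clovers through `x` only read links based at times `≥ x₀ − 1`,
  so `S_x`, `P_x` are observables of the closed site half `{t ≥ 0}` when `x₀ ≥ 1` and of the
  closed link half `{t ≥ 1}` when `x₀ ≥ 2`.

Nothing here bears on the Yang–Mills mass gap; no summit, leg or crux statement is proved
(seat ym-line-fcl-p3 g19, free hands).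
-/

noncomputable section

open Literature.MathematicalPhysics.QuantumLattice
open Literature.Probability.LatticeModels (Site)
open Summit.QuantumFields.GaugeBoot

namespace Summit.QuantumFields.YangMills.Theorems

namespace CloverParityRP

/-! ### Translations of the clover densities -/

section Translate

variable {d : ℕ} {R : Type*} [AddCommGroup R] [One R] {N : ℕ} {G : Type*} [Group G]
  (ρ : G →* Matrix (Fin N) (Fin N) ℂ)

/-- A clover sum read through a translation-like relabelling `φ` of the sites (additive along
every unit vector) is the clover sum at `φ x`. -/
theorem cloverLeafSum_translate (φ : (Fin d → R) → (Fin d → R))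
    (hφ : ∀ y (i : Fin d), φ (y + Pi.single i 1) = φ y + Pi.single i 1)
    (U V : (Fin d → R) × Fin d → G) (hV : ∀ y (i : Fin d), V (y, i) = U (φ y, i))
    (x : Fin d → R) (μ ν : Fin d) :
    cloverLeafSum (fun e => ρ (V e)) x μ ν = cloverLeafSum (fun e => ρ (U e)) (φ x) μ ν := by
  have hφ' : ∀ y (i : Fin d), φ (y - Pi.single i 1) = φ y - Pi.single i 1 := fun y i =>
    reflect_sub_single_of_add (fun z => hφ z i) y
  simp only [cloverLeafSum, hV, hφ, hφ']

/-- The bare clover read through a translation-like relabelling. -/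
theorem flowedClover_zero_translate (φ : (Fin d → R) → (Fin d → R))
    (hφ : ∀ y (i : Fin d), φ (y + Pi.single i 1) = φ y + Pi.single i 1)
    (U V : (Fin d → R) × Fin d → G) (hV : ∀ y (i : Fin d), V (y, i) = U (φ y, i))
    (x : Fin d → R) (μ ν : Fin d) :
    flowedClover ρ 0 V x μ ν = flowedClover ρ 0 U (φ x) μ ν := by
  rw [flowedClover_zero, flowedClover_zero, cloverLeafSum_translate ρ φ hφ U V hV]

/-- The clover action density read through a translation-like relabelling. -/
theorem flowedCloverEnergy_zero_translate (φ : (Fin d → R) → (Fin d → R))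
    (hφ : ∀ y (i : Fin d), φ (y + Pi.single i 1) = φ y + Pi.single i 1)
    (U V : (Fin d → R) × Fin d → G) (hV : ∀ y (i : Fin d), V (y, i) = U (φ y, i))
    (x : Fin d → R) : flowedCloverEnergy ρ 0 x V = flowedCloverEnergy ρ 0 (φ x) U := by
  simp only [flowedCloverEnergy, flowedClover_zero_translate ρ φ hφ U V hV]

/-- The clover pseudoscalar density read through a translation-like relabelling. -/
theorem cloverPseudoscalar_translate (φ : (Fin 4 → R) → (Fin 4 → R))
    (hφ : ∀ y (i : Fin 4), φ (y + Pi.single i 1) = φ y + Pi.single i 1)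
    (U V : (Fin 4 → R) × Fin 4 → G) (hV : ∀ y (i : Fin 4), V (y, i) = U (φ y, i))
    (x : Fin 4 → R) : cloverPseudoscalar ρ x V = cloverPseudoscalar ρ (φ x) U := by
  simp only [cloverPseudoscalar, flowedClover_zero_translate ρ φ hφ U V hV]

variable [MeasurableSpace G]

/-- `S_x(shift_v U) = S_{x - v}(U)` on `ℤᵈ`. -/
theorem flowedCloverEnergy_zero_configShift (v x : Site d) (U : LGConfig d G) :
    flowedCloverEnergy ρ 0 x (configShift v U) = flowedCloverEnergy ρ 0 (x - v) U :=
  flowedCloverEnergy_zero_translate ρ (fun y => y - v) (fun y _ => add_sub_right_comm y _ v) U _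
    (fun y i => configShift_apply v U (y, i)) x

/-- `P_x(shift_v U) = P_{x - v}(U)` on `ℤ⁴`. -/
theorem cloverPseudoscalar_configShift (v x : Site 4) (U : LGConfig 4 G) :
    cloverPseudoscalar ρ x (configShift v U) = cloverPseudoscalar ρ (x - v) U :=
  cloverPseudoscalar_translate ρ (fun y => y - v) (fun y _ => add_sub_right_comm y _ v) U _
    (fun y i => configShift_apply v U (y, i)) x

end Translate

/-! ### The two Osterwalder–Seiler time mirrors of `ℤᵈ` (axis `0`) on the clover densities -/

section Reflect

variable {d : ℕ} [NeZero d] {N : ℕ} {G : Type*} [Group G] (ρ : G →* Matrix (Fin N) (Fin N) ℂ)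

omit [NeZero d] in
/-- The site mirror reverses `e₀`: `θ(y + e₀) = θy − e₀`. -/
theorem zdSiteReflect_add_single_zero (i : Fin d) (y : Site d) :
    zdSiteReflect i (y + Pi.single i 1) = zdSiteReflect i y - Pi.single i 1 := by
  have h := zdSiteReflect_sub_single i (y + Pi.single i 1)
  rw [add_sub_cancel_right] at h
  rw [h, add_sub_cancel_right]

omit [NeZero d] in
/-- The site mirror carries the other unit vectors along. -/
theorem zdSiteReflect_add_single_of_ne {i j : Fin d} (hj : j ≠ i) (y : Site d) :
    zdSiteReflect i (y + Pi.single j 1) = zdSiteReflect i y + Pi.single j 1 := by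
  ext k
  by_cases hk : k = i
  · subst hk
    simp [zdSiteReflect, Pi.single_eq_of_ne hj.symm]
  · simp [zdSiteReflect, hk]

omit [NeZero d] in
/-- The link mirror reverses `e₀`: `θ(y + e₀) = θy − e₀`. -/
theorem zdLinkReflect_add_single_zero (i : Fin d) (y : Site d) :
    zdLinkReflect i (y + Pi.single i 1) = zdLinkReflect i y - Pi.single i 1 := by
  have h := zdLinkReflect_sub_single i (y + Pi.single i 1)
  rw [add_sub_cancel_right] at h
  rw [h, add_sub_cancel_right]

omit [NeZero d] in
/-- The link mirror carries the other unit vectors along. -/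
theorem zdLinkReflect_add_single_of_ne {i j : Fin d} (hj : j ≠ i) (y : Site d) :
    zdLinkReflect i (y + Pi.single j 1) = zdLinkReflect i y + Pi.single j 1 := by
  ext k
  by_cases hk : k = i
  · subst hk
    simp [zdLinkReflect, Pi.single_eq_of_ne hj.symm]
  · simp [zdLinkReflect, hk]

/-- **`S` is even under the site mirror `x₀ = 0`** (unitary `ρ`). -/
theorem flowedCloverEnergy_zero_configSiteReflect (hρ : ∀ g, ρ g ∈ Matrix.unitaryGroup (Fin N) ℂ)
    (x : Site d) (U : LGConfig d G) :
    flowedCloverEnergy ρ 0 x (configSiteReflect 0 U) =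
      flowedCloverEnergy ρ 0 (zdSiteReflect 0 x) U :=
  flowedCloverEnergy_zero_reflect ρ hρ (zdSiteReflect 0) (zdSiteReflect_add_single_zero 0)
    (fun y _ hi => zdSiteReflect_add_single_of_ne hi y) U _
    (fun y => by simp [configSiteReflect, zdSiteReflect_add_single_zero])
    (fun y i hi => by simp [configSiteReflect, hi]) x

/-- **`S` is even under the link mirror `x₀ = ½`** (unitary `ρ`). -/
theorem flowedCloverEnergy_zero_configLinkReflect (hρ : ∀ g, ρ g ∈ Matrix.unitaryGroup (Fin N) ℂ)
    (x : Site d) (U : LGConfig d G) :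
    flowedCloverEnergy ρ 0 x (configLinkReflect 0 U) =
      flowedCloverEnergy ρ 0 (zdLinkReflect 0 x) U :=
  flowedCloverEnergy_zero_reflect ρ hρ (zdLinkReflect 0) (zdLinkReflect_add_single_zero 0)
    (fun y _ hi => zdLinkReflect_add_single_of_ne hi y) U _
    (fun y => by simp [configLinkReflect, zdLinkReflect_add_single_zero])
    (fun y i hi => by simp [configLinkReflect, hi]) x

variable {G : Type*} [Group G] (ρ : G →* Matrix (Fin N) (Fin N) ℂ)

/-- **`P` is odd under the site mirror `x₀ = 0`** (unitary `ρ`). -/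
theorem cloverPseudoscalar_configSiteReflect (hρ : ∀ g, ρ g ∈ Matrix.unitaryGroup (Fin N) ℂ)
    (x : Site 4) (U : LGConfig 4 G) :
    cloverPseudoscalar ρ x (configSiteReflect 0 U) = -cloverPseudoscalar ρ (zdSiteReflect 0 x) U :=
  cloverPseudoscalar_reflect ρ hρ (zdSiteReflect 0) (zdSiteReflect_add_single_zero 0)
    (fun y _ hi => zdSiteReflect_add_single_of_ne hi y) U _
    (fun y => by simp [configSiteReflect, zdSiteReflect_add_single_zero])
    (fun y i hi => by simp [configSiteReflect, hi]) x

/-- **`P` is odd under the link mirror `x₀ = ½`** (unitary `ρ`). -/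
theorem cloverPseudoscalar_configLinkReflect (hρ : ∀ g, ρ g ∈ Matrix.unitaryGroup (Fin N) ℂ)
    (x : Site 4) (U : LGConfig 4 G) :
    cloverPseudoscalar ρ x (configLinkReflect 0 U) = -cloverPseudoscalar ρ (zdLinkReflect 0 x) U :=
  cloverPseudoscalar_reflect ρ hρ (zdLinkReflect 0) (zdLinkReflect_add_single_zero 0)
    (fun y _ hi => zdLinkReflect_add_single_of_ne hi y) U _
    (fun y => by simp [configLinkReflect, zdLinkReflect_add_single_zero])
    (fun y i hi => by simp [configLinkReflect, hi]) x

end Reflect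

/-! ### Supports: the six `μ < ν` clovers through `x` live in `{t ≥ x₀ − 1}` -/

section Support

variable {d : ℕ} [NeZero d] {N : ℕ} {G : Type*} [Group G] (ρ : G →* Matrix (Fin N) (Fin N) ℂ)

omit [NeZero d] in
/-- The time component of a unit vector is `0` or `1`. -/
theorem single_apply_mem (μ k : Fin d) :
    0 ≤ (Pi.single μ (1 : ℤ) : Fin d → ℤ) k ∧ (Pi.single μ (1 : ℤ) : Fin d → ℤ) k ≤ 1 := by
  by_cases h : k = μ
  · subst h; simp
  · simp [Pi.single_eq_of_ne h]

omit [NeZero d] in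
/-- Two distinct unit vectors have total time component at most `1`. -/
theorem single_add_single_apply_le {μ ν : Fin d} (hμν : μ ≠ ν) (k : Fin d) :
    (Pi.single μ (1 : ℤ) : Fin d → ℤ) k + (Pi.single ν (1 : ℤ) : Fin d → ℤ) k ≤ 1 := by
  by_cases hμ : k = μ
  · subst hμ
    simp [Pi.single_eq_of_ne hμν]
  · have := (single_apply_mem ν k).2
    simp [Pi.single_eq_of_ne hμ, this]

omit [NeZero d] in
/-- **The links of an off-diagonal clover through `x` are based at times `≥ x_k − 1`** (in every
coordinate `k`). -/
theorem sub_one_le_of_mem_cloverEdges {μ ν : Fin d} (hμν : μ ≠ ν) {x : Site d} {e : ZdEdge d}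
    (he : e ∈ cloverEdges x μ ν) (k : Fin d) : x k - 1 ≤ e.1 k := by
  have hμb := single_apply_mem μ k
  have hνb := single_apply_mem ν k
  have hs := single_add_single_apply_le hμν k
  simp only [cloverEdges, Finset.mem_insert, Finset.mem_singleton] at he
  rcases he with rfl | rfl | rfl | rfl | rfl | rfl | rfl | rfl | rfl | rfl | rfl | rfl <;>
    simp only [Pi.add_apply, Pi.sub_apply] <;> omega

omit [NeZero d] in
/-- `S_x` only depends on the off-diagonal clovers through `x`. -/
theorem flowedCloverEnergy_zero_congr_offDiag {U V : LGConfig d G} {x : Site d}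
    (h : ∀ μ ν : Fin d, μ ≠ ν → ∀ e ∈ cloverEdges x μ ν, U e = V e) :
    flowedCloverEnergy ρ 0 x U = flowedCloverEnergy ρ 0 x V := by
  unfold flowedCloverEnergy
  refine Finset.sum_congr rfl fun μ _ => Finset.sum_congr rfl fun ν _ => ?_
  split_ifs with hμν
  · rw [flowedClover_zero_congr ρ (h μ ν (ne_of_lt hμν))]
  · rfl

/-- `P_x` only depends on the off-diagonal clovers through `x`. -/
theorem cloverPseudoscalar_congr_offDiag {U V : LGConfig 4 G} {x : Site 4}
    (h : ∀ μ ν : Fin 4, μ ≠ ν → ∀ e ∈ cloverEdges x μ ν, U e = V e) :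
    cloverPseudoscalar ρ x U = cloverPseudoscalar ρ x V := by
  have hC : ∀ μ ν : Fin 4, μ ≠ ν → flowedClover ρ 0 U x μ ν = flowedClover ρ 0 V x μ ν :=
    fun μ ν hμν => flowedClover_zero_congr ρ (h μ ν hμν)
  rw [cloverPseudoscalar, cloverPseudoscalar, hC 0 1 (by decide), hC 2 3 (by decide),
    hC 0 2 (by decide), hC 1 3 (by decide), hC 0 3 (by decide), hC 1 2 (by decide)]

/-- **`S_x` is an observable of the closed half `{t ≥ 0}` of the site mirror when `x₀ ≥ 1`.** -/
theorem dependsOn_flowedCloverEnergy_siteHalf {x : Site d} (hx : 1 ≤ x 0) :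
    DependsOn (fun U : LGConfig d G => flowedCloverEnergy ρ 0 x U) (siteHalfEdges 0) :=
  fun _ _ hUV => flowedCloverEnergy_zero_congr_offDiag ρ fun _ _ hμν e he =>
    hUV e (show (0 : ℤ) ≤ e.1 0 by have := sub_one_le_of_mem_cloverEdges hμν he 0; omega)

/-- **`S_x` is an observable of the closed half `{t ≥ 1}` of the link mirror when `x₀ ≥ 2`.** -/
theorem dependsOn_flowedCloverEnergy_linkHalf {x : Site d} (hx : 2 ≤ x 0) :
    DependsOn (fun U : LGConfig d G => flowedCloverEnergy ρ 0 x U) (linkHalfEdges 0) :=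
  fun _ _ hUV => flowedCloverEnergy_zero_congr_offDiag ρ fun _ _ hμν e he =>
    hUV e (show (1 : ℤ) ≤ e.1 0 by have := sub_one_le_of_mem_cloverEdges hμν he 0; omega)

/-- **`P_x` is an observable of the closed half `{t ≥ 0}` of the site mirror when `x₀ ≥ 1`.** -/
theorem dependsOn_cloverPseudoscalar_siteHalf {x : Site 4} (hx : 1 ≤ x 0) :
    DependsOn (fun U : LGConfig 4 G => cloverPseudoscalar ρ x U) (siteHalfEdges 0) :=
  fun _ _ hUV => cloverPseudoscalar_congr_offDiag ρ fun _ _ hμν e he =>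
    hUV e (show (0 : ℤ) ≤ e.1 0 by have := sub_one_le_of_mem_cloverEdges hμν he 0; omega)

/-- **`P_x` is an observable of the closed half `{t ≥ 1}` of the link mirror when `x₀ ≥ 2`.** -/
theorem dependsOn_cloverPseudoscalar_linkHalf {x : Site 4} (hx : 2 ≤ x 0) :
    DependsOn (fun U : LGConfig 4 G => cloverPseudoscalar ρ x U) (linkHalfEdges 0) :=
  fun _ _ hUV => cloverPseudoscalar_congr_offDiag ρ fun _ _ hμν e he =>
    hUV e (show (1 : ℤ) ≤ e.1 0 by have := sub_one_le_of_mem_cloverEdges hμν he 0; omega)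

end Support

end CloverParityRP

end Summit.QuantumFields.YangMills.Theorems

end
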